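import Summits.ValiantsHypothesis.ValiantsHypothesis.Theorems.LacunarySymmetroidMatrixDescartesRangeObligations
import Literature.Algebra.Polynomial.ErdosTuranPositiveZerosProofs
import Literature.Algebra.Polynomial.ErdosTuranPositiveZerosHolds

/-!
# `MatrixDescartes` — line «range» §9 UNCONDITIONAL: the violator structure with the Erdős–Turán hypothesis DISCHARGED

`…RangeObligations.violator_degree` / `.violator_natDegree_ge` (val-port-4 g1; the port of §9 of the crux workfile
`Cruxes/MatrixDescartes/Lines/range.lean`, val-idea-6 g4) carry the explicit binder `hET` = «Erdős–Turán on the positive axis: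
`Z₊² ≤ 256 · deg q · log(‖q‖₁/√|a₀·a_N|)` for real `q` with `q(0) ≠ 0`».  That binder is now a THEOREM of the tree:
`Literature.Algebra.Polynomial.ErdosTuran1950_positiveZeros_holds` (val-lit-p11 g1, p620775; Erdős–Turán 1950 / Schur, constant
`2` for roots with multiplicity over `ℂ`) and its corollary `ErdosTuran1950_positiveZeros.positiveAxis` (val-lit-p9,
`…ErdosTuranPositiveZerosProofs`) whose statement is the binder `hET` token-for-token (`l1 q` unfolds to the coefficient
`ℓ¹`-sum).  This file records the two unconditional corollaries, by name (one `exact` each).  Crux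
`Summit.ValiantsHypothesis.ValiantsHypothesis.Theses.LacunarySymmetroid.MatrixDescartes` (stmt-18050) is HEIGHT-FREE and stays
OPEN; nothing here bounds a violator's degree from above or bears on `VP ≠ VNP`.  Helper (`--supports … 18050 --as helper`),
0 defs, 0 facts.  [folklore] (composition by name).
-/

-- `Summit.ValiantsHypothesis.ValiantsHypothesis.…` repeats a component by the D-0017 layout
-- (single-conjunct summit), which the `dupNamespace` linter flags; the name is mandated.
set_option linter.dupNamespace false

noncomputable section

namespace Summit.ValiantsHypothesis.ValiantsHypothesis.Theorems.LacunarySymmetroidMatrixDescartes.RangeObligations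

open scoped BigOperators Matrix
open Polynomial
open Summit.ValiantsHypothesis.ValiantsHypothesis.Theorems.LacunarySymmetroidMatrixDescartes.FiniteSector
open Literature.Algebra.Polynomial (ErdosTuran1950_positiveZeros_holds)

/-- **Violator structure, UNCONDITIONAL** (`violator_degree` with `hET := ErdosTuran1950_positiveZeros_holds.positiveAxis`):
a pencil with letters `≤ h` and `|c₀·lc| ≥ 1` has `Z₊² ≤ 256 · deg(det P) · log(m!·(K h)^m)` — at quasi-polynomial height a
violator of the crux's rate is a degree-inefficient, non-full pencil. [folklore] -/
theorem violator_degree_unconditional {m K : ℕ} (d : Fin K → ℕ) (S : Fin K → Matrix (Fin m) (Fin m) ℝ) {h : ℝ}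
    (hS : ∀ l i j, |S l i j| ≤ h)
    (hends : 1 ≤ |(pencil d S).det.coeff 0 * (pencil d S).det.leadingCoeff|) :
    ((((pencil d S).det.roots.filter (0 < ·)).toFinset.card : ℕ) : ℝ) ^ 2
      ≤ 256 * (pencil d S).det.natDegree * Real.log ((m.factorial : ℝ) * (K * h) ^ m) :=
  violator_degree ErdosTuran1950_positiveZeros_holds.positiveAxis d S hS hends

/-- **Degree floor of a violator, UNCONDITIONAL** (`violator_natDegree_ge` with `hET` discharged): whenever the height budget
`m!·(K h)^m` exceeds `1`, `deg(det P) ≥ Z₊² / (256 · log(m!·(K h)^m))`. [folklore] -/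
theorem violator_natDegree_ge_unconditional {m K : ℕ} (d : Fin K → ℕ) (S : Fin K → Matrix (Fin m) (Fin m) ℝ) {h : ℝ}
    (hS : ∀ l i j, |S l i j| ≤ h)
    (hends : 1 ≤ |(pencil d S).det.coeff 0 * (pencil d S).det.leadingCoeff|)
    (hbudget : 1 < (m.factorial : ℝ) * (K * h) ^ m) :
    ((((pencil d S).det.roots.filter (0 < ·)).toFinset.card : ℕ) : ℝ) ^ 2
        / (256 * Real.log ((m.factorial : ℝ) * (K * h) ^ m))
      ≤ (pencil d S).det.natDegree :=
  violator_natDegree_ge ErdosTuran1950_positiveZeros_holds.positiveAxis d S hS hends hbudget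

end Summit.ValiantsHypothesis.ValiantsHypothesis.Theorems.LacunarySymmetroidMatrixDescartes.RangeObligations

end
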